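import Mathlib
import HarnessLib.Audit
import Summits.PneNP.PneNP.Theorems.PstarGateCaseTN3Tools

/-!
# One GATED chord, CASE T without the affine hypothesis: `q_mv` vanishes where the gated chord is ON, and private tree edges lie on the gated cycle (E2 node N4X; prover-1 g20)

FRONTIER range-avoidance ladder, rung F-N3 (`stmt-PneNP-19007`), cell `pnp-ideate` (`PstarGateNodesX.GateCaseTQuadX`); restricted-model proof
complexity — nothing here bears on `P` versus `NP`.

CASE T (the other chords read along one transverse `mv ∈ {(0,1),(1,1)}` and are read), at least one other chord, one gate of coefficient
`ℓ = κ₀ + x_u`, chamber `H₁ = {x_u = κ₀ + 1}`.  Two facts that `PstarGateCaseTN3Tools.private_mem_cycle` obtained from the affine hypothesis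
(`polarDir mv = 0`) hold in general:

* `caseT_q_zero_of_on` — **on `H₁`, `u_e = 1 ⟹ q_mv = 0`**: at a chamber point with `q_mv = 1` the enlarged forcing set (`PstarGateCaseT.caseT_forced`)
  switches every other chord ON, while the coupling `u_{e'} = u_e + 1` (`PstarGateCaseTPairExc.caseT_coupled`) switches it OFF;
* `exists_on_on_chamber` — a chamber point with `u_e = 1` (flip the AND pair of a `u`-avoiding edge at an OFF point);
* `private_mem_cycle_quad` — **every tree edge private within `J₀ ∪ {g₀}` lies on `D e`, avoids `u`, and is private within `D e`**, with NO
  hypothesis on `q_mv`: a private edge on no fundamental set is unread by the second constraint (the four OFF chamber points of the affine proof,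
  `caseT_off_q`), unread in direction `mv` (four ON chamber points and `caseT_q_zero_of_on`: the second difference of `q_mv` along the private
  pair is `mv.2·[j ∈ T₁] + mv.1·[j ∈ T₂]`, `polarDir_single_pair`), hence in neither join — an unread bridge, impossible by
  `PstarBridgeUnread.false_of_bridge_minimal`.
-/

set_option linter.dupNamespace false -- `Summit.PneNP.PneNP.…`: summit = sub-problem name (D-0017 single-conjunct layout)

open Finset Module Literature.Computability.Complexity
open scoped symmDiff
open Summit.PneNP.PneNP.Theorems.PstarTyped (Typed)
open Summit.PneNP.PneNP.Theorems.PstarSALevel (varSet bdry BoundaryExpanding SimpleOverlap)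
open Summit.PneNP.PneNP.Theorems.PstarGapLinearised (andPair andPair_subset_varSet)
open Summit.PneNP.PneNP.Theorems.PstarChordEndgameTools (mem_andPair_iff)
open Summit.PneNP.PneNP.Theorems.PstarCentreFree (vars_mem_varSet)
open Summit.PneNP.PneNP.Theorems.PstarCoreBound (XorClosed)
open Summit.PneNP.PneNP.Theorems.PstarProductRank (qform polar)
open Summit.PneNP.PneNP.Theorems.PstarPathRank (AndAdj polar_basis)
open Summit.PneNP.PneNP.Theorems.PstarPathRankFibre (avoid)
open Summit.PneNP.PneNP.Theorems.PstarReadSumset (V2)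
open Summit.PneNP.PneNP.Theorems.PstarChordSystem (ChordSystem)
open Summit.PneNP.PneNP.Theorems.PstarChordBridgeTools (privs coef)
open Summit.PneNP.PneNP.Theorems.PstarChordBridge (BridgeData sys Solution Lift infeasible_of_not_solution)
open Summit.PneNP.PneNP.Theorems.PstarChordBridgeForcing (gam sys_u_eq)
open Summit.PneNP.PneNP.Theorems.PstarChordBridgeBasis (qDir polarDir)
open Summit.PneNP.PneNP.Theorems.PstarChordBridgeCorner (qDir_add andAdj_iff_mem)
open Summit.PneNP.PneNP.Theorems.PstarNorUnitEQ1Tools (polarDir_single_pair)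
open Summit.PneNP.PneNP.Theorems.PstarGateBridge (GateHyp)
open Summit.PneNP.PneNP.Theorems.PstarGateHyperplane (qform_single_and)
open Summit.PneNP.PneNP.Theorems.PstarGateCaseT (caseT_forced)
open Summit.PneNP.PneNP.Theorems.PstarGateCaseTLocal (u_add)
open Summit.PneNP.PneNP.Theorems.PstarGateNodes (GateData)
open Summit.PneNP.PneNP.Theorems.PstarGateNodesX (GateDataX)
open Summit.PneNP.PneNP.Theorems.PstarGateFibreRank (avoid_nonempty)
open Summit.PneNP.PneNP.Theorems.PstarGateU2BranchB (exists_off_on_chamber)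
open Summit.PneNP.PneNP.Theorems.PstarGateU2Joins (polar_single_off)
open Summit.PneNP.PneNP.Theorems.PstarBridgeUnread (false_of_bridge_minimal)
open Summit.PneNP.PneNP.Theorems.PstarGateCaseTOffQ (caseT_off_q)
open Summit.PneNP.PneNP.Theorems.PstarGateCaseTRankSix (sigma_const)
open Summit.PneNP.PneNP.Theorems.PstarGateCaseTPairExc (caseT_coupled)
open Summit.PneNP.PneNP.Theorems.PstarGateCaseTStructure (caseT_through)

namespace Summit.PneNP.PneNP.Theorems.PstarGateCaseTPrivateCycleQuad

variable {n m : ℕ}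

/-- Second differences of a quadratic function along two directions. -/
private theorem quad_two {q : (Fin n → ZMod 2) → ZMod 2} {Bf : LinearMap.BilinForm (ZMod 2) (Fin n → ZMod 2)}
    (hq : ∀ x w, q (x + w) = q x + q w + q 0 + Bf x w) (y v w : Fin n → ZMod 2) :
    q (y + v + w) = q (y + v) + q (y + w) + q y + Bf v w := by
  have h1 := hq (y + v) w
  have h2 := hq y w
  rw [map_add, LinearMap.add_apply] at h1
  rw [h1, h2]
  generalize q (y + v) = a; generalize q y = b; generalize q w = c; generalize q 0 = d; generalize Bf y w = s; generalize Bf v w = t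
  revert a b c d s t; decide

section CaseT

variable (I : LocalMap 4 n m) (hI : I.IsPure xorAndPred) (hT : Typed I) (hS : SimpleOverlap I) {r₀ : ℕ} (hB : BoundaryExpanding r₀ I)
  {B : BridgeData n m} {e g₀ : Fin m} {u : Fin n} {κ₀ : ZMod 2} (hD : GateDataX I r₀ B e g₀ u κ₀) {mv : V2} (hmvT : mv = (0, 1) ∨ mv = (1, 1))
  (hP : ∀ e' ∈ B.N, e' ≠ e → ∀ a, ((sys I B).ρ e' a = 0 ∨ (sys I B).ρ e' a = mv) ∧ ((sys I B).ρ' e' a = 0 ∨ (sys I B).ρ' e' a = mv))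
  (hread : ∀ e' ∈ B.N, e' ≠ e → ∀ a, (sys I B).ρ e' a ≠ 0 ∨ (sys I B).ρ' e' a ≠ 0) (hN : (B.N.erase e).Nonempty)
include hI hT hS hB hD hmvT hP hread hN

/-- **On the chamber, `u_e = 1 ⟹ q_mv = 0`** (CASE T with another chord).  See the module docstring. -/
theorem caseT_q_zero_of_on {x : Fin n → ZMod 2} (hxu : x u = κ₀ + 1) (hue : (sys I B).u e x = 1) : qDir I B mv x = 0 := by
  classical
  obtain ⟨-, hW, -, -, -, hL, -, -, hG, -, -, -, -, -, -, hcoef, hT3, -⟩ := id hD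
  obtain ⟨c, hc⟩ := hN
  obtain ⟨hce, hcN⟩ := mem_erase.1 hc
  by_contra hq
  have hq1 : qDir I B mv x = 1 := by
    have z01 : ∀ t : ZMod 2, t ≠ 0 → t = 1 := by decide
    exact z01 _ hq
  have hl : coef I B.C₁ B.G₁ (I.vars e 2) x = 1 := by
    rw [hcoef, hxu]
    have e2 : ∀ k : ZMod 2, k + (k + 1) = 1 := by decide
    exact e2 κ₀
  have hx : ((sys I B).u e x = 0 ∧ coef I B.C₁ B.G₁ (I.vars e 2) x = 1) ∨
      qDir I B mv x + (sys I B).u e x * coef I B.C₁ B.G₁ (I.vars e 2) x = 0 := by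
    right; rw [hq1, hue, hl]; decide
  have hon := caseT_forced I hI hT hW hL hG hT3 hmvT hP hread hx c hcN hce
  have hcpl := caseT_coupled I hI hT hS hB hD hmvT hcN hce (hP c hcN hce) (hread c hcN hce) x hxu
  rw [sys_u_eq, hon, hue] at hcpl
  revert hcpl; generalize gam B c = g; revert g; decide

omit hT hB hmvT hP hread hN in
/-- **A chamber point where the gated chord is ON.** -/
theorem exists_on_on_chamber : ∃ x : Fin n → ZMod 2, x u = κ₀ + 1 ∧ (sys I B).u e x = 1 := by
  classical
  obtain ⟨-, hW, -, -, -, -, -, -, hG, -⟩ := id hD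
  have he : e ∈ B.N := hG.1
  have heD : e ∉ B.D e := fun h => (mem_sdiff.1 (hW.hD e he h)).2 he
  obtain ⟨y, hyu, hUy⟩ := exists_off_on_chamber I hI hS hW he u (κ₀ + 1)
  obtain ⟨k, hk⟩ := avoid_nonempty I hI hS heD (hW.hDeven e he) u
  unfold PstarPathRankFibre.avoid at hk
  obtain ⟨hkD, hk2, hk3⟩ := mem_filter.1 hk
  rw [mem_singleton] at hk2 hk3
  set ec : Fin n → ZMod 2 := Pi.single (I.vars k 2) 1 with hec
  set ed : Fin n → ZMod 2 := Pi.single (I.vars k 3) 1 with hed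
  have hcu : ec u = 0 := by rw [hec, Pi.single_eq_of_ne (Ne.symm hk2)]
  have hdu : ed u = 0 := by rw [hed, Pi.single_eq_of_ne (Ne.symm hk3)]
  have hpol : polar (B.D e) (fun j => I.vars j 2) (fun j => I.vars j 3) ec ed = 1 := by
    rw [hec, hed, polar_basis I hI hS, if_pos ((andAdj_iff_mem I hI hS (B.D e) k).2 hkD)]
  have hquad := quad_two (u_add I B e) y ec ed
  rw [hpol, hUy] at hquad
  by_contra hno
  push Not at hno
  have z01 : ∀ t : ZMod 2, t ≠ 1 → t = 0 := by decide
  have h1 := z01 _ (hno (y + ec) (by rw [Pi.add_apply, hyu, hcu, add_zero]))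
  have h2 := z01 _ (hno (y + ed) (by rw [Pi.add_apply, hyu, hdu, add_zero]))
  have h3 := z01 _ (hno (y + ec + ed) (by rw [Pi.add_apply, Pi.add_apply, hyu, hcu, hdu, add_zero, add_zero]))
  rw [h1, h2, h3] at hquad
  exact absurd hquad (by decide)

/-- **Private tree edges lie on the gated cycle** (CASE T, no hypothesis on `q_mv`).  See the module docstring. -/
theorem private_mem_cycle_quad {j : Fin m} (hj : j ∈ B.J₀ \ B.N)
    (hpriv : ∀ j' ∈ insert g₀ B.J₀, j' ≠ j → I.vars j 2 ∉ varSet I j' ∧ I.vars j 3 ∉ varSet I j') :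
    j ∈ B.D e ∧ I.vars j 2 ≠ u ∧ I.vars j 3 ≠ u ∧ ∀ j' ∈ B.D e, j' ≠ j → I.vars j 2 ∉ andPair I j' ∧ I.vars j 3 ∉ andPair I j' := by
  classical
  have hon_q : ∀ {x : Fin n → ZMod 2}, x u = κ₀ + 1 → (sys I B).u e x = 1 → qDir I B mv x = 0 :=
    fun hxu hue => caseT_q_zero_of_on I hI hT hS hB hD hmvT hP hread hN hxu hue
  obtain ⟨y₁, hy₁u, hUy₁⟩ := exists_on_on_chamber I hI hS hD
  obtain ⟨hXc, hW, hr, hd₁, hd₂, hL, -, -, hG, hg₀, hgv, -, -, -, -, -, hT3, hM0⟩ := id hD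
  have he : e ∈ B.N := hG.1
  obtain ⟨hjJ, hjN⟩ := mem_sdiff.1 hj
  have hg₀J : g₀ ∉ B.J₀ := fun h => disjoint_left.1 hd₁ hg₀ h
  have hu_g₀ : u ∈ varSet I g₀ := by rcases hgv with ⟨-, h⟩ | ⟨h, -⟩ <;> exact h ▸ vars_mem_varSet I g₀ _
  have hgj := hpriv g₀ (mem_insert_self _ _) (fun h => hg₀J (h ▸ hjJ))
  have hj2 : I.vars j 2 ≠ u := fun h => hgj.1 (h ▸ hu_g₀)
  have hj3 : I.vars j 3 ≠ u := fun h => hgj.2 (h ▸ hu_g₀)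
  have hDpriv : ∀ D ⊆ B.J₀, ∀ j' ∈ D, j' ≠ j → I.vars j 2 ∉ andPair I j' ∧ I.vars j 3 ∉ andPair I j' := fun D hD' j' hj' hne =>
    ⟨fun h => (hpriv j' (mem_insert_of_mem (hD' hj')) hne).1 (andPair_subset_varSet I j' h),
     fun h => (hpriv j' (mem_insert_of_mem (hD' hj')) hne).2 (andPair_subset_varSet I j' h)⟩
  have hDeJ : B.D e ⊆ B.J₀ := fun k hk => (mem_sdiff.1 (hW.hD e he hk)).1
  -- `j ∈ D e`
  have hjD : j ∈ B.D e := by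
    by_contra hjDe
    -- on another fundamental set, `j` would be that chord's `u`-edge
    have hjDc : ∀ c ∈ B.N, j ∉ B.D c := by
      intro c hc hjc
      by_cases hce : c = e
      · exact hjDe (hce ▸ hjc)
      have hthr := (caseT_through I hI hT hS hB hD hmvT hP hread hc hce).1 j (Finset.mem_symmDiff.2 (Or.inr ⟨hjc, hjDe⟩))
      rcases hthr with h | h
      · exact hj2 h
      · exact hj3 h
    set a := I.vars j 2 with ha
    set b := I.vars j 3 with hb
    set ea : Fin n → ZMod 2 := Pi.single a 1 with hea
    set eb : Fin n → ZMod 2 := Pi.single b 1 with heb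
    have haDe : a ∉ (B.D e).biUnion (andPair I) := by
      intro h; obtain ⟨j', hj', hv⟩ := mem_biUnion.1 h
      exact (hDpriv _ hDeJ j' hj' (fun h' => hjDe (h' ▸ hj'))).1 hv
    have hbDe : b ∉ (B.D e).biUnion (andPair I) := by
      intro h; obtain ⟨j', hj', hv⟩ := mem_biUnion.1 h
      exact (hDpriv _ hDeJ j' hj' (fun h' => hjDe (h' ▸ hj'))).2 hv
    have hUU : ∀ y w, (sys I B).u e (y + w) = (sys I B).u e y + (sys I B).u e w + (sys I B).u e 0 +
        polar (B.D e) (fun j => I.vars j 2) (fun j => I.vars j 3) y w := u_add I B e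
    have hU0 : ∀ v : Fin n, (sys I B).u e (Pi.single v 1) = (sys I B).u e 0 := by
      intro v; rw [sys_u_eq, sys_u_eq, qform_single_and I hI]; unfold qform; simp
    have hsym : ∀ y w, polar (B.D e) (fun j => I.vars j 2) (fun j => I.vars j 3) y w =
        polar (B.D e) (fun j => I.vars j 2) (fun j => I.vars j 3) w y := PstarPathRank.polar_symm_and I (B.D e)
    have hUa : ∀ y', (sys I B).u e (y' + ea) = (sys I B).u e y' := by
      intro y'
      rw [hUU, hsym, hea, polar_single_off I (B.D e) haDe, hU0]
      generalize (sys I B).u e y' = s; generalize (sys I B).u e 0 = t; revert s t; decide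
    have hUb : ∀ y', (sys I B).u e (y' + eb) = (sys I B).u e y' := by
      intro y'
      rw [hUU, hsym, heb, polar_single_off I (B.D e) hbDe, hU0]
      generalize (sys I B).u e y' = s; generalize (sys I B).u e 0 = t; revert s t; decide
    have hau : ea u = 0 := by rw [hea, Pi.single_eq_of_ne (Ne.symm hj2)]
    have hbu : eb u = 0 := by rw [heb, Pi.single_eq_of_ne (Ne.symm hj3)]
    -- (1) `j ∉ T₂`: four OFF chamber points
    have hjT₂ : j ∉ B.T₂ := by
      intro hjT₂
      have hτ2 : polarDir I B (1, 0) (Pi.single (I.vars j 2) 1) (Pi.single (I.vars j 3) 1) = 1 := by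
        have h := polarDir_single_pair I hI hS hd₁ hd₂ (1, 0) hjJ
        simp only [zero_mul, zero_add, one_mul, if_pos hjT₂] at h
        exact h
      obtain ⟨y, hyu, hUy⟩ := exists_off_on_chamber I hI hS hW he u (κ₀ + 1)
      have hoff : ∀ y' : Fin n → ZMod 2, y' u = κ₀ + 1 → (sys I B).u e y' = 0 →
          qDir I B (1, 0) y' = 1 + ∑ i ∈ B.N.erase e, (((sys I B).ρ i 0).2 + ((sys I B).ρ' i 0).2) := by
        intro y' hy'u hUy'
        have h := caseT_off_q I hI hT hD hmvT hP hread hy'u hUy'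
        rw [sigma_const I hW hG] at h
        exact h
      have h1 := hoff y hyu hUy
      have h2 := hoff (y + ea) (by rw [Pi.add_apply, hyu, hau, add_zero]) (by rw [hUa, hUy])
      have h3 := hoff (y + eb) (by rw [Pi.add_apply, hyu, hbu, add_zero]) (by rw [hUb, hUy])
      have h4 := hoff (y + ea + eb) (by rw [Pi.add_apply, Pi.add_apply, hyu, hau, hbu, add_zero, add_zero]) (by rw [hUb, hUa, hUy])
      have hquad := quad_two (qDir_add I B (1, 0)) y ea eb
      rw [h1, h2, h3, h4, hτ2] at hquad
      generalize ∑ i ∈ B.N.erase e, (((sys I B).ρ i 0).2 + ((sys I B).ρ' i 0).2) = s at hquad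
      revert hquad; revert s; decide
    -- (2) `j ∉ T₁`: four ON chamber points
    have hjT₁ : j ∉ B.T₁ := by
      intro hjT₁
      have hτ : polarDir I B mv (Pi.single (I.vars j 2) 1) (Pi.single (I.vars j 3) 1) = 1 := by
        have h := polarDir_single_pair I hI hS hd₁ hd₂ mv hjJ
        rw [if_pos hjT₁, if_neg hjT₂, mul_one, mul_zero, add_zero] at h
        rw [h]
        rcases hmvT with hm | hm <;> rw [hm]
      have h1 := hon_q hy₁u hUy₁
      have h2 := hon_q (x := y₁ + ea) (by rw [Pi.add_apply, hy₁u, hau, add_zero]) (by rw [hUa, hUy₁])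
      have h3 := hon_q (x := y₁ + eb) (by rw [Pi.add_apply, hy₁u, hbu, add_zero]) (by rw [hUb, hUy₁])
      have h4 := hon_q (x := y₁ + ea + eb) (by rw [Pi.add_apply, Pi.add_apply, hy₁u, hau, hbu, add_zero, add_zero])
        (by rw [hUb, hUa, hUy₁])
      have hquad := quad_two (qDir_add I B mv) y₁ ea eb
      rw [h1, h2, h3, h4, hτ] at hquad
      exact absurd hquad (by decide)
    -- so `j` is an unread bridge
    have hinf : (sys I B).Infeasible B.N := infeasible_of_not_solution I hI hT hW hL hT3
    obtain ⟨z, hz⟩ := hM0 j hjJ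
    exact false_of_bridge_minimal I hI hT hW hXc hinf hj hjDc hjT₁ hjT₂ hz
  exact ⟨hjD, hj2, hj3, hDpriv _ hDeJ⟩

end CaseT

end Summit.PneNP.PneNP.Theorems.PstarGateCaseTPrivateCycleQuad
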